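import Summits.Ventures.LatticeQCDFlow.Scoring.MadrasSokalRatioCLT
import Summits.Ventures.LatticeQCDFlow.Scoring.LagProductGaussianLimit
import Summits.Ventures.LatticeQCDFlow.Scoring.MovingAverageCLT

/-!
# The Gaussian moving average satisfies EVERY hypothesis of the packet: `X_i = Σ_j a_j ξ_{i+j}`, `ξ` i.i.d. `N(0,1)`, is a block factor AND a stationary Wick family — so `√N (τ̂_W − τ_W) ⇒ N(0, R(W))` holds for it with nothing left to assume

HONEST FRAMING: exact (Metropolis-corrected) sampling algorithms for lattice gauge theory;
figures of merit are autocorrelation/cost numbers at stated couplings and volumes; no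
continuum-physics claim.

Venture `LatticeQCDFlow` (cell pub-lqcd), sub-topic `Scoring`; FANOUT row 16 (`su2-base`), GEN-7.
NEW WORK of the cell over `Scoring/MadrasSokalRatioCLT`, `Scoring/LagProductGaussianLimit`,
`Scoring/MovingAverageCLT` (`maMap`, `maACF`, `maCov`), GEN-6's
`Scoring/LagProductCovariance` (`gaussLin`, `gramCov`, `isWickFamily_gaussLin` = Isserlis via the
Literature's `integral_quartForm_stdGaussian`) and Mathlib (`map_pi_eq_stdGaussian`,
`iIndepFun_iff_map_fun_eq_pi_map`); nothing is cited as a fact.  Printed counterpart NAMED ONLY: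
Lehmann 1999 Example 2.8.1 / eq. (2.8.7) (moving averages), Isserlis 1918.

Last file of the LAW-OF-THE-ERROR packet: NON-VACUITY OF THE CONJUNCTION.  The crown
theorem `MadrasSokalRatioCLT.tendstoInDistribution_tauIntWindow_wick` assumes a process that is BOTH
a block factor of an i.i.d. sequence AND a stationary Wick family with summable normalised covariance.
The Gaussian moving average is both; here every hypothesis is discharged and the theorem is restated
for it with no assumption beyond 'ξ i.i.d. standard normal, `a ≠ 0`'.

## Contents

* `maCov_eq_evenExt` (the MA second moments in GEN-6's `σ² ρ̄(k−i)` form, `σ² = γ(0)`, `ρ = γ/γ(0)`),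
  `maRho`.
* `maCoef a M n` (the coefficient row of `X_n` on a window of length `M`), **`gaussLin_maCoef`**
  (`X_n` is GEN-6's `gaussLin` of the window vector), **`gramCov_maCoef`** (`gramCov = maCov`).
* `windowVec`, **`map_windowVec_eq_stdGaussian`** (an i.i.d. `N(0,1)` window IS `stdGaussian (ℝ^M)`),
  `blockFactor_maMap_eq_gaussLin`, **`isWickFamily_maMap`** — THE GAUSSIAN MA IS A WICK FAMILY with
  second moments `maCov a` (each of the three Wick axioms transferred to a long-enough window).
* **`gaussianMA_tauIntWindow_clt`** — for `ξ` i.i.d. `N(0,1)`, `a ≠ 0`, every `W`: with `Σ = Σ_{m+W}`,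
  `Z = id ~ multivariateGaussian 0 Σ`, `ℓ = tauHatGrad W (γ(0) ρ)`:
  `√N (τ̂_W(N) − tauIntWindow ρ W) ⇒ ⟪ℓ, Z⟫` and `⟪ℓ, Z⟫ ~ N(0, tauHatRatioAVar ρ W)`.

NOT CLAIMED: non-Gaussian innovations (then the Wick identification fails and `Σ` carries the fourth
cumulant — the CLT `tendstoInDistribution_tauIntWindow` still holds with `ℓᵀ Σ ℓ`); `MA(∞)`/`AR`
processes; `R(W) > 0`.
-/

noncomputable section

open MeasureTheory ProbabilityTheory Filter Finset WithLp
open scoped Topology NNReal RealInnerProductSpace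

namespace Summit.Ventures.LatticeQCDFlow.Scoring


/-! ## Coefficient rows on a finite window and GEN-6's `gaussLin` -/

section Rows

variable {m : ℕ}

/-- The MA second moments in GEN-6's `σ² ρ̄(k − i)` form, `ρ = γ/γ(0)`. -/
theorem maCov_eq_evenExt {a : Fin (m + 1) → ℝ} (ha : a ≠ 0) (i k : ℕ) :
    maCov a i k = maACF a 0 * evenExt (fun n => maACF a n / maACF a 0) ((k : ℤ) - i) := by
  rw [maCov_eq_maACF, evenExt]
  field_simp [(maACF_zero_pos ha).ne']

/-- The coefficient row of `X_n` on the window `ξ_0, …, ξ_{M-1}`: `p ↦ a_{p−n}` on `n ≤ p ≤ n + m`,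
`0` elsewhere (written as a sum of indicators to avoid subtraction). [ours] -/
def maCoef (a : Fin (m + 1) → ℝ) (M n : ℕ) (p : Fin M) : ℝ :=
  ∑ j : Fin (m + 1), if n + (j : ℕ) = (p : ℕ) then a j else 0

/-- On a window containing `n, …, n + m`, GEN-6's linear statistic with the MA coefficient row is
`Σ_j a_j v_{n+j}`. -/
theorem gaussLin_maCoef (a : Fin (m + 1) → ℝ) {M n : ℕ} (hn : n + m < M)
    (v : EuclideanSpace ℝ (Fin M)) :
    gaussLin (EuclideanSpace.basisFun (Fin M) ℝ) (maCoef a M) n v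
      = ∑ j : Fin (m + 1), a j * v ⟨n + j, by omega⟩ := by
  simp only [gaussLin, maCoef, EuclideanSpace.basisFun_inner, sum_mul]
  rw [sum_comm]
  refine sum_congr rfl fun j _ => ?_
  simp only [ite_mul, zero_mul]
  rw [← sum_filter]
  have hf : (univ.filter fun p : Fin M => n + (j : ℕ) = (p : ℕ)) = {⟨n + j, by omega⟩} := by
    ext p
    simp only [mem_filter, mem_univ, true_and, mem_singleton, Fin.ext_iff]
    omega
  rw [hf, sum_singleton]

/-- One summand of the Gram covariance: `Σ_p [i+j = p] a_j · [k+j' = p] a_{j'} = [i+j = k+j'] a_j a_{j'}`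
(the window contains `i + j`). -/
theorem sum_ite_mul_ite (a : Fin (m + 1) → ℝ) {M i : ℕ} (hi : i + m < M) (k : ℕ)
    (j j' : Fin (m + 1)) :
    ∑ p : Fin M, (if i + (j : ℕ) = (p : ℕ) then a j else 0) * (if k + (j' : ℕ) = (p : ℕ) then a j' else 0)
      = if i + (j : ℕ) = k + j' then a j * a j' else 0 := by
  rw [Finset.sum_eq_single ⟨i + j, by omega⟩]
  · simp only [if_true]
    by_cases h : i + (j : ℕ) = k + j'
    · rw [if_pos h, if_pos h.symm]
    · rw [if_neg h, if_neg (fun h' => h h'.symm), mul_zero]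
  · intro p _ hp
    rw [if_neg (fun h => hp (Fin.ext h.symm)), zero_mul]
  · intro h; exact absurd (mem_univ _) h

/-- The Gram covariance of the coefficient rows is the MA second moment (window large enough). -/
theorem gramCov_maCoef (a : Fin (m + 1) → ℝ) {M i : ℕ} (hi : i + m < M) (k : ℕ) :
    gramCov (maCoef a M) i k = maCov a i k := by
  simp only [gramCov, maCoef, maCov, sum_mul_sum]
  rw [sum_comm]
  refine sum_congr rfl fun j _ => ?_
  rw [sum_comm]
  refine sum_congr rfl fun j' _ => ?_
  exact sum_ite_mul_ite a hi k j j'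

end Rows

/-! ## The Gaussian moving average is a Wick family -/

section Gaussian

variable {Ω : Type*} [MeasurableSpace Ω] {P : Measure Ω} [IsProbabilityMeasure P]
variable {ξ : ℕ → Ω → ℝ} {m : ℕ}

/-- The window `(ξ_0, …, ξ_{M−1})` as a random vector of `ℝ^M`. [ours] -/
def windowVec (ξ : ℕ → Ω → ℝ) (M : ℕ) : Ω → EuclideanSpace ℝ (Fin M) :=
  fun ω => toLp 2 fun p : Fin M => ξ p ω

omit [IsProbabilityMeasure P] in
/-- `windowVec` is measurable. -/
theorem measurable_windowVec (hξ : ∀ i, Measurable (ξ i)) (M : ℕ) : Measurable (windowVec ξ M) :=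
  (WithLp.measurable_toLp 2 _).comp (measurable_pi_lambda _ fun p => hξ p)

/-- **An i.i.d. `N(0,1)` window is a standard Gaussian vector** (independence = product law,
`map_pi_eq_stdGaussian`). -/
theorem map_windowVec_eq_stdGaussian (hξ : ∀ i, Measurable (ξ i)) (hind : iIndepFun ξ P)
    (hlaw : ∀ i, HasLaw (ξ i) (gaussianReal 0 1) P) (M : ℕ) :
    P.map (windowVec ξ M) = stdGaussian (EuclideanSpace ℝ (Fin M)) := by
  have h1 : iIndepFun (fun p : Fin M => ξ p) P := hind.precomp Fin.val_injective
  have h2 := (iIndepFun_iff_map_fun_eq_pi_map (fun p : Fin M => (hξ p).aemeasurable)).1 h1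
  have h3 : (fun p : Fin M => P.map (ξ p)) = fun _ => gaussianReal 0 1 :=
    funext fun p => (hlaw p).map_eq
  have hm : Measurable (fun ω (p : Fin M) => ξ p ω) := measurable_pi_lambda _ fun p => hξ p
  rw [show windowVec ξ M = (toLp 2) ∘ (fun ω (p : Fin M) => ξ p ω) from rfl,
    ← Measure.map_map (WithLp.measurable_toLp 2 _) hm, h2, h3, map_pi_eq_stdGaussian]

omit [MeasurableSpace Ω] [IsProbabilityMeasure P] in
/-- `X_n` IS GEN-6's linear statistic of the window vector (window containing `n, …, n + m`). -/
theorem blockFactor_maMap_eq_gaussLin (a : Fin (m + 1) → ℝ) (ξ : ℕ → Ω → ℝ) {M n : ℕ}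
    (hn : n + m < M) :
    blockFactor (maMap a) ξ n
      = fun ω => gaussLin (EuclideanSpace.basisFun (Fin M) ℝ) (maCoef a M) n (windowVec ξ M ω) := by
  funext ω
  rw [gaussLin_maCoef a hn, blockFactor_maMap]
  rfl

/-- **THE GAUSSIAN MOVING AVERAGE IS A WICK FAMILY** with second moments `maCov a`
(Isserlis, through GEN-6's `isWickFamily_gaussLin` on a window long enough for the indices at hand). -/
theorem isWickFamily_maMap (hξ : ∀ i, Measurable (ξ i)) (hind : iIndepFun ξ P)
    (hlaw : ∀ i, HasLaw (ξ i) (gaussianReal 0 1) P) (a : Fin (m + 1) → ℝ) :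
    IsWickFamily (blockFactor (maMap a) ξ) (maCov a) P where
  memLp i j := by
    set M := i + j + m + 1 with hM
    set b := EuclideanSpace.basisFun (Fin M) ℝ
    have e : (fun ω => blockFactor (maMap a) ξ i ω * blockFactor (maMap a) ξ j ω)
        = (fun v => gaussLin b (maCoef a M) i v * gaussLin b (maCoef a M) j v) ∘ windowVec ξ M := by
      funext ω
      rw [blockFactor_maMap_eq_gaussLin a ξ (by omega : i + m < M),
        blockFactor_maMap_eq_gaussLin a ξ (by omega : j + m < M)]
      rfl
    rw [e]
    refine MemLp.comp_of_map ?_ (measurable_windowVec hξ M).aemeasurable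
    rw [map_windowVec_eq_stdGaussian hξ hind hlaw M]
    exact memLp_gaussLin_mul b (maCoef a M) i j
  two i j := by
    set M := i + j + m + 1 with hM
    set b := EuclideanSpace.basisFun (Fin M) ℝ
    have e : ∀ ω, blockFactor (maMap a) ξ i ω * blockFactor (maMap a) ξ j ω
        = (fun v => gaussLin b (maCoef a M) i v * gaussLin b (maCoef a M) j v) (windowVec ξ M ω) := by
      intro ω
      rw [blockFactor_maMap_eq_gaussLin a ξ (by omega : i + m < M),
        blockFactor_maMap_eq_gaussLin a ξ (by omega : j + m < M)]
    calc (∫ ω, blockFactor (maMap a) ξ i ω * blockFactor (maMap a) ξ j ω ∂P)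
        = ∫ ω, (fun v => gaussLin b (maCoef a M) i v * gaussLin b (maCoef a M) j v)
            (windowVec ξ M ω) ∂P := integral_congr_ae (ae_of_all _ e)
      _ = ∫ v, gaussLin b (maCoef a M) i v * gaussLin b (maCoef a M) j v ∂(P.map (windowVec ξ M)) :=
          (integral_map (measurable_windowVec hξ M).aemeasurable
            ((continuous_gaussLin b _ i).mul (continuous_gaussLin b _ j)).aestronglyMeasurable).symm
      _ = gramCov (maCoef a M) i j := by
          rw [map_windowVec_eq_stdGaussian hξ hind hlaw M, integral_gaussLin_mul]
      _ = maCov a i j := gramCov_maCoef a (by omega) j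
  four i j k l := by
    set M := i + j + k + l + m + 1 with hM
    set b := EuclideanSpace.basisFun (Fin M) ℝ
    have e : ∀ ω, blockFactor (maMap a) ξ i ω * blockFactor (maMap a) ξ j ω
          * blockFactor (maMap a) ξ k ω * blockFactor (maMap a) ξ l ω
        = (fun v => gaussLin b (maCoef a M) i v * gaussLin b (maCoef a M) j v
            * gaussLin b (maCoef a M) k v * gaussLin b (maCoef a M) l v) (windowVec ξ M ω) := by
      intro ω
      rw [blockFactor_maMap_eq_gaussLin a ξ (by omega : i + m < M),
        blockFactor_maMap_eq_gaussLin a ξ (by omega : j + m < M),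
        blockFactor_maMap_eq_gaussLin a ξ (by omega : k + m < M),
        blockFactor_maMap_eq_gaussLin a ξ (by omega : l + m < M)]
    calc (∫ ω, blockFactor (maMap a) ξ i ω * blockFactor (maMap a) ξ j ω
          * blockFactor (maMap a) ξ k ω * blockFactor (maMap a) ξ l ω ∂P)
        = ∫ ω, (fun v => gaussLin b (maCoef a M) i v * gaussLin b (maCoef a M) j v
            * gaussLin b (maCoef a M) k v * gaussLin b (maCoef a M) l v) (windowVec ξ M ω) ∂P :=
          integral_congr_ae (ae_of_all _ e)
      _ = ∫ v, gaussLin b (maCoef a M) i v * gaussLin b (maCoef a M) j v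
            * gaussLin b (maCoef a M) k v * gaussLin b (maCoef a M) l v ∂(P.map (windowVec ξ M)) :=
          (integral_map (measurable_windowVec hξ M).aemeasurable
            ((((continuous_gaussLin b _ i).mul (continuous_gaussLin b _ j)).mul
              (continuous_gaussLin b _ k)).mul (continuous_gaussLin b _ l)).aestronglyMeasurable).symm
      _ = gramCov (maCoef a M) i j * gramCov (maCoef a M) k l
          + gramCov (maCoef a M) i k * gramCov (maCoef a M) j l
          + gramCov (maCoef a M) i l * gramCov (maCoef a M) j k := by
          rw [map_windowVec_eq_stdGaussian hξ hind hlaw M, integral_gaussLin_four]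
      _ = maCov a i j * maCov a k l + maCov a i k * maCov a j l + maCov a i l * maCov a j k := by
          rw [gramCov_maCoef a (by omega) j, gramCov_maCoef a (by omega) l,
            gramCov_maCoef a (by omega) k, gramCov_maCoef a (by omega) l,
            gramCov_maCoef a (by omega) l, gramCov_maCoef a (by omega) k]

/-- The normalised MA autocorrelation `ρ(n) = γ(n)/γ(0)`. [ours] -/
def maRho (a : Fin (m + 1) → ℝ) (n : ℕ) : ℝ := maACF a n / maACF a 0

/-- **THE LAW OF THE ERROR OF THE ERROR FOR GAUSSIAN MOVING-AVERAGE DATA — every hypothesis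
discharged.**  Let `ξ₀, ξ₁, …` be i.i.d. standard normal, `a ≠ 0` a coefficient vector of length
`m + 1`, `X_i = Σ_j a_j ξ_{i+j}` (`MA(m)`), `ρ = maRho a` its autocorrelation (`τ_int = ½ + Σ_{t≥1} ρ(t)`),
`W` a window, `Σ = lagProdACov X (m+W)` (symmetric positive semidefinite) and `ℓ` the gradient of the
ratio map at `γ(0) ρ`.  Then, with `Z ~ N(0, Σ)` realised on `(ℝ^{W+1}, multivariateGaussian 0 Σ)`:
`√N (τ̂_W(N) − τ_W) ⇒ ⟪ℓ, Z⟫` AND `⟪ℓ, Z⟫ ~ N(0, R(W))`, `R(W) = tauHatRatioAVar ρ W` (GEN-6). -/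
theorem gaussianMA_tauIntWindow_clt (hξ : ∀ i, Measurable (ξ i)) (hind : iIndepFun ξ P)
    (hlaw : ∀ i, HasLaw (ξ i) (gaussianReal 0 1) P) {a : Fin (m + 1) → ℝ} (ha : a ≠ 0) (W : ℕ) :
    TendstoInDistribution
      (fun (N : ℕ) ω => Real.sqrt N
        * (tauIntWindow (fun t => acovHat (blockFactor (maMap a) ξ) N t ω
            / acovHat (blockFactor (maMap a) ξ) N 0 ω) W - tauIntWindow (maRho a) W))
      atTop (fun z : EuclideanSpace ℝ (Fin (W + 1)) =>
        ⟪tauHatGrad W (toLp 2 fun t : Fin (W + 1) => maACF a 0 * maRho a t), z⟫) (fun _ => P)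
      (multivariateGaussian 0 (Matrix.of fun s t : Fin (W + 1) =>
        lagProdACov (blockFactor (maMap a) ξ) P (m + W) s t))
    ∧ HasLaw (fun z : EuclideanSpace ℝ (Fin (W + 1)) =>
        ⟪tauHatGrad W (toLp 2 fun t : Fin (W + 1) => maACF a 0 * maRho a t), z⟫)
      (gaussianReal 0 (tauHatRatioAVar (maRho a) W).toNNReal)
      (multivariateGaussian 0 (Matrix.of fun s t : Fin (W + 1) =>
        lagProdACov (blockFactor (maMap a) ξ) P (m + W) s t)) := by
  have hid : ∀ i, IdentDistrib (ξ i) (ξ 0) P P := fun i =>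
    ⟨(hξ i).aemeasurable, (hξ 0).aemeasurable, by rw [(hlaw i).map_eq, (hlaw 0).map_eq]⟩
  have hW := isWickFamily_maMap hξ hind hlaw a
  have hC : ∀ i j, maCov a i j = maACF a 0 * evenExt (maRho a) ((j : ℤ) - i) :=
    fun i j => maCov_eq_evenExt ha i j
  have hσ : maACF a 0 ≠ 0 := (maACF_zero_pos ha).ne'
  have h0 : maRho a 0 = 1 := div_self hσ
  obtain ⟨hZm, hZ⟩ := gaussianLimit_acovHat_realised hξ hind hid (measurable_maMap a)
    (fun t => hW.memLp 0 t) W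
  exact tendstoInDistribution_tauIntWindow_wick hξ hind hid (measurable_maMap a) hW hC hσ h0
    (summable_maACF_div a) W hZm hZ

end Gaussian

end Summit.Ventures.LatticeQCDFlow.Scoring

end
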